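import Mathlib
import Summits.ResolutionOfSingularities.ResolutionOfSingularities.Theorems.WeightedInvariantLocalWeightedDropNCResSurfGraphTangent
import Summits.ResolutionOfSingularities.ResolutionOfSingularities.Theorems.WeightedInvariantLocalWeightedDropTOT2E1Presentation
import Summits.ResolutionOfSingularities.ResolutionOfSingularities.Theorems.WeightedInvariantLocalWeightedDropTOT2CurveSwap

/-!
# `WeightedInvariant.LocalWeightedDrop`: NC-resolution settings for the TOT₂ line — GRAPH SURFACES, part 8: SWAPPING THE TWO BASE LETTERS
# (the graph datum `(a, b, ψ)` and `(b, a, ψ ∘ swap)` present the same surface; the tangent directions are exchanged)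

Crux item stmt-ResolutionOfSingularities-8899 `LocalWeightedDrop` (route `ResolutionOfSingularities/WeightedInvariant`), ENGINE skeleton v32/v33, residuals
`stub_spaceNCRankDrop` / `stub_wildWideApexFourStartsWon` (res-L1-w43-strat-1's line `directrix-cut` v3.1, piece PL = `ApexPlaneExit`, SURFACE sub-case;
design memo `L/res-L1-w43-stub-4/g5/S-E2-SURF.md`).  [OURS · L1 W4.3 · chain w43 · seat res-L1-w43-stub-4 gen 5; def-free bookkeeping on parts 1, 3;
the count game is the programme's own; nothing here is a statement of any manuscript; AI-produced, gate-checked, weaker than expert review.]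

The point-move step (parts 6–7) reads the successor at the base slot `a` when `c′_a ≠ 0`; when `c′_a = 0` (then `c′_b ≠ 0`, part 5) one first swaps the
roles of the base letters.  The swap of the two variables of `k⟦u₁, u₂⟧` is the substitution `![X 1, X 0]` (res-type-088's
`TOT2Curve.hasSubst_swap`, …TOT2CurveSwap):
* `shear_swap` — `shear a b ψ = shear b a (ψ_j(u₂, u₁))_j`;
* `tangentL_swap`, `tangentR_swap` — `tangentL a b ψ = tangentR b a ψ^{sw}`, `tangentR a b ψ = tangentL b a ψ^{sw}`;
* `constantCoeff_swap` — the swap keeps constant terms (so the graph-datum hypotheses persist).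
-/

set_option linter.dupNamespace false -- mandated namespace of this single-conjunct summit

noncomputable section

namespace Summit.ResolutionOfSingularities.ResolutionOfSingularities.Theorems

namespace TameFourTupleDrop

namespace GraphSurf

open MvPowerSeries Literature.AlgebraicGeometry.Resolution

variable {k : Type} [Field k] {m : ℕ}

/-- The swap is the renaming along `Equiv.swap 0 1`. -/
theorem subst_swap_eq_rename (ψ : MvPowerSeries (Fin 2) k) :
    subst (![X 1, X 0] : Fin 2 → MvPowerSeries (Fin 2) k) ψ = rename (Equiv.swap (0 : Fin 2) 1).toEmbedding ψ := by
  rw [rename_eq_subst]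
  congr 1
  funext t
  fin_cases t <;> rfl

/-- The swap keeps constant terms. -/
theorem constantCoeff_swap (ψ : MvPowerSeries (Fin 2) k) :
    constantCoeff (subst (![X 1, X 0] : Fin 2 → MvPowerSeries (Fin 2) k) ψ) = constantCoeff ψ :=
  TOT2E1.constantCoeff_subst_of_constantCoeff_zero _ TOT2Curve.constantCoeff_swapFamily ψ

/-- The swap exchanges the two linear coefficients. -/
theorem coeff_single_zero_swap (ψ : MvPowerSeries (Fin 2) k) :
    coeff (Finsupp.single 0 1) (subst (![X 1, X 0] : Fin 2 → MvPowerSeries (Fin 2) k) ψ) = coeff (Finsupp.single 1 1) ψ := by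
  rw [subst_swap_eq_rename]
  exact NCTransport.coeff_single_rename_self (Equiv.swap (0 : Fin 2) 1).toEmbedding ψ 1

/-- The swap exchanges the two linear coefficients. -/
theorem coeff_single_one_swap (ψ : MvPowerSeries (Fin 2) k) :
    coeff (Finsupp.single 1 1) (subst (![X 1, X 0] : Fin 2 → MvPowerSeries (Fin 2) k) ψ) = coeff (Finsupp.single 0 1) ψ := by
  rw [subst_swap_eq_rename]
  exact NCTransport.coeff_single_rename_self (Equiv.swap (0 : Fin 2) 1).toEmbedding ψ 0

/-- `ψ^{sw}(x_b, x_a) = ψ(x_a, x_b)`. -/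
theorem onPlane_swap (a b : Fin (m + 1)) (ψ : MvPowerSeries (Fin 2) k) :
    onPlane b a (subst (![X 1, X 0] : Fin 2 → MvPowerSeries (Fin 2) k) ψ) = onPlane a b ψ := by
  rw [onPlane, onPlane, subst_comp_subst_apply TOT2Curve.hasSubst_swap (hasSubst_base b a)]
  congr 1
  funext t
  fin_cases t
  · simp [subst_X (hasSubst_base b a)]
  · simp [subst_X (hasSubst_base b a)]

/-- **SWAPPING THE BASE LETTERS**: `shear a b ψ = shear b a ψ^{sw}`. -/
theorem shear_swap (a b : Fin (m + 1)) (ψ : Fin (m + 1) → MvPowerSeries (Fin 2) k) :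
    shear a b ψ = shear b a (fun j => subst (![X 1, X 0] : Fin 2 → MvPowerSeries (Fin 2) k) (ψ j)) := by
  funext j
  by_cases h : j = a ∨ j = b
  · rw [shear_of_base h, shear_of_base (Or.comm.mp h)]
  · rw [shear_of_ne h, shear_of_ne (fun h' => h (Or.comm.mp h')), onPlane_swap]

/-- The swapped datum has zero constant terms off the base. -/
theorem constantCoeff_swap_of_ne {a b : Fin (m + 1)} {ψ : Fin (m + 1) → MvPowerSeries (Fin 2) k}
    (hψ : ∀ j, ¬ (j = a ∨ j = b) → constantCoeff (ψ j) = 0) :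
    ∀ j, ¬ (j = b ∨ j = a) → constantCoeff (subst (![X 1, X 0] : Fin 2 → MvPowerSeries (Fin 2) k) (ψ j)) = 0 :=
  fun j hj => by rw [constantCoeff_swap]; exact hψ j (fun h => hj (Or.comm.mp h))

/-- The first tangent direction is the second one of the swapped datum. -/
theorem tangentL_swap {a b : Fin (m + 1)} (hab : a ≠ b) (ψ : Fin (m + 1) → MvPowerSeries (Fin 2) k) :
    tangentL a b ψ = tangentR b a (fun j => subst (![X 1, X 0] : Fin 2 → MvPowerSeries (Fin 2) k) (ψ j)) := by
  funext j
  by_cases h : j = a ∨ j = b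
  · rcases h with rfl | rfl
    · rw [tangentL_left, tangentR_right _ (Ne.symm hab)]
    · rw [tangentL_right _ hab, tangentR_left]
  · rw [tangentL_of_ne _ h, tangentR_of_ne _ (fun h' => h (Or.comm.mp h')), coeff_single_one_swap]

/-- The second tangent direction is the first one of the swapped datum. -/
theorem tangentR_swap {a b : Fin (m + 1)} (hab : a ≠ b) (ψ : Fin (m + 1) → MvPowerSeries (Fin 2) k) :
    tangentR a b ψ = tangentL b a (fun j => subst (![X 1, X 0] : Fin 2 → MvPowerSeries (Fin 2) k) (ψ j)) := by
  funext j
  by_cases h : j = a ∨ j = b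
  · rcases h with rfl | rfl
    · rw [tangentR_left, tangentL_right _ (Ne.symm hab)]
    · rw [tangentR_right _ hab, tangentL_left]
  · rw [tangentR_of_ne _ h, tangentL_of_ne _ (fun h' => h (Or.comm.mp h')), coeff_single_zero_swap]

/-- An answer in the tangent plane, rewritten for the swapped datum (the roles of `c′_a`, `c′_b` exchanged). -/
theorem eq_combo_tangent_swap {a b : Fin (m + 1)} (hab : a ≠ b) {ψ : Fin (m + 1) → MvPowerSeries (Fin 2) k} {c' : Fin (m + 1) → k}
    (hc' : c' = c' a • tangentL a b ψ + c' b • tangentR a b ψ) :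
    c' = c' b • tangentL b a (fun j => subst (![X 1, X 0] : Fin 2 → MvPowerSeries (Fin 2) k) (ψ j)) +
      c' a • tangentR b a (fun j => subst (![X 1, X 0] : Fin 2 → MvPowerSeries (Fin 2) k) (ψ j)) := by
  rw [← tangentL_swap hab, ← tangentR_swap hab, add_comm (c' b • tangentR a b ψ)]
  exact hc'

end GraphSurf

end TameFourTupleDrop

end Summit.ResolutionOfSingularities.ResolutionOfSingularities.Theorems

end
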